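import Summits.Ventures.PercRepro2.CaseOnePendantPath
import Summits.Ventures.PercRepro2.CaseOneRootsOnlyQ
import Summits.Ventures.PercRepro2.CaseOneRootsOnlyI
import Summits.Ventures.PercRepro2.CaseOneRootsAndOQ
import Summits.Ventures.PercRepro2.CaseOneRootsAndOI

/-!
# Pendant paths at a roots-only vertex and at a roots-and-`o` vertex
(blind cell PercRepro2, p1 g21; S5 §2.1: `fourForms_of_pendantPath` at two more closed anchors)

The roots-only class (`a₃` adjacent only to `a₁`, `a₂`; `CaseOneRootsOnly*`) and the roots-and-`o` class
(`a₃` adjacent to `a₁`, `a₂` and `o`; `CaseOneRootsAndO*`) have all four forms `(ii)`, `(ii-Q)`, `(i)`,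
`(i-Q)` in the tree, so `fourForms_of_pendantPath` (CaseOnePendantPath) applies: **every row of the class
table for every vertex at the end of a pendant path of any length hanging at a roots-only vertex
(`*_of_pendantPath_rootsOnly`) or at a roots-and-`o` vertex (`*_of_pendantPath_rootsAndO`)**, for every
finite graph and every weight vector. The anchor predicates `RootsOnlyAnchor` / `RootsAndOAnchor` are the
hypotheses of the four closers, with the inequalities made symmetric in the roots. Own code; standard axioms. -/

namespace Summit.Ventures.PercRepro2

namespace CaseOne

universe u

section AnchorDefs
variable {V : Type*}

/-- The roots-only anchor: every edge at `v` goes to `a₁` or to `a₂`, and `v ∉ {a₁, a₂, b}`. -/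
def RootsOnlyAnchor (_o a₁ a₂ b : V) (E : Type u) (ends : E → Sym2 V) (v : V) : Prop :=
  (∀ e, v ∈ ends e → ends e = s(a₁, v) ∨ ends e = s(a₂, v)) ∧ a₁ ≠ v ∧ a₂ ≠ v ∧ b ≠ v

/-- The roots-and-`o` anchor: one edge `{o, v}`, every other edge at `v` goes to `a₁` or to `a₂`, and
`v ∉ {o, a₁, a₂, b}`. -/
def RootsAndOAnchor (o a₁ a₂ b : V) (E : Type u) (ends : E → Sym2 V) (v : V) : Prop :=
  ∃ e₀ : E, ends e₀ = s(o, v) ∧ (∀ e, v ∈ ends e → e ≠ e₀ → ends e = s(a₁, v) ∨ ends e = s(a₂, v)) ∧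
    o ≠ v ∧ a₁ ≠ v ∧ a₂ ≠ v ∧ b ≠ v

variable (o a₁ a₂ b : V)

/-- The roots-only anchor is symmetric in the roots. -/
theorem RootsOnlyAnchor.swap (E : Type u) (ends : E → Sym2 V) (v : V)
    (h : RootsOnlyAnchor o a₁ a₂ b E ends v) : RootsOnlyAnchor o a₂ a₁ b E ends v := by
  obtain ⟨hroot, h1, h2, hb⟩ := h
  exact ⟨fun e he => (hroot e he).symm, h2, h1, hb⟩

/-- The roots-and-`o` anchor is symmetric in the roots. -/
theorem RootsAndOAnchor.swap (E : Type u) (ends : E → Sym2 V) (v : V)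
    (h : RootsAndOAnchor o a₁ a₂ b E ends v) : RootsAndOAnchor o a₂ a₁ b E ends v := by
  obtain ⟨e₀, he₀, hroot, ho, h1, h2, hb⟩ := h
  exact ⟨e₀, he₀, fun e he hne => (hroot e he hne).symm, ho, h2, h1, hb⟩

end AnchorDefs

section Anchors
variable {V : Type*} [Fintype V] [DecidableEq V] {R : Type*} [Field R] [LinearOrder R]
  [IsStrictOrderedRing R]
variable (o a₁ a₂ b : V)

/-- A roots-only anchor has the four forms (`CaseOneRootsOnly`, `RootsOnlyI`, `RootsOnlyQ`). -/
theorem fourForms_of_rootsOnlyAnchor (E : Type u) [Fintype E] [DecidableEq E] (ends : E → Sym2 V)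
    (p : E → R) (hp : IsProbVec p) (v : V) (h : RootsOnlyAnchor o a₁ a₂ b E ends v) :
    FourForms p ends o a₁ a₂ v b := by
  obtain ⟨hroot, h1, -, hb⟩ := h
  exact ⟨zSplitII_of_rootsOnly p hp hroot h1 o b, zSplitIIQ_of_rootsOnly p hp hroot h1 o b,
    zSplitI_of_rootsOnly p hp hroot h1 o hb, zSplitIQ_of_rootsOnly p hp hroot h1 o hb⟩

/-- A roots-and-`o` anchor has the four forms (`CaseOneRootsAndMark`, `RootsAndOI`, `RootsAndOQ`). -/
theorem fourForms_of_rootsAndOAnchor (E : Type u) [Fintype E] [DecidableEq E] (ends : E → Sym2 V)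
    (p : E → R) (hp : IsProbVec p) (v : V) (h : RootsAndOAnchor o a₁ a₂ b E ends v) :
    FourForms p ends o a₁ a₂ v b := by
  obtain ⟨e₀, he₀, hroot, ho, h1, h2, hb⟩ := h
  exact ⟨zSplitII_of_rootsAndO p hp he₀ hroot ho h1 h2 hb, zSplitIIQ_of_rootsAndO p hp he₀ hroot ho h1 b,
    zSplitI_of_rootsAndO p hp he₀ hroot ho h1 hb, zSplitIQ_of_rootsAndO p hp he₀ hroot ho h1 hb⟩

variable {E : Type u} [Fintype E] [DecidableEq E] {ends : E → Sym2 V} {v a₃ : V} {n : ℕ}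

/-- **The four forms at the end of a pendant path of any length at a roots-only vertex.** -/
theorem fourForms_of_pendantPath_rootsOnly (p : E → R) (hp : IsProbVec p)
    (h : IsPendantPathAt (RootsOnlyAnchor o a₁ a₂ b) o a₁ a₂ b n E ends v a₃) :
    FourForms p ends o a₁ a₂ a₃ b :=
  fourForms_of_pendantPath (RootsOnlyAnchor o a₁ a₂ b) o a₁ a₂ b
    (fourForms_of_rootsOnlyAnchor o a₁ a₂ b) n E ends p hp v a₃ h

/-- **`(J1)` at the end of a pendant path of any length at a roots-only vertex.** -/
theorem jOne_of_pendantPath_rootsOnly (p : E → R) (hp : IsProbVec p)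
    (h : IsPendantPathAt (RootsOnlyAnchor o a₁ a₂ b) o a₁ a₂ b n E ends v a₃) :
    JOne p ends o a₁ a₂ a₃ b :=
  jOne_of_pendantPath (RootsOnlyAnchor o a₁ a₂ b) (fourForms_of_rootsOnlyAnchor o a₁ a₂ b)
    (fun E' _ _ ends' p' hp' v' h' =>
      fourForms_of_rootsOnlyAnchor o a₂ a₁ b E' ends' p' hp' v' (RootsOnlyAnchor.swap o a₁ a₂ b E' ends' v' h'))
    p hp h

/-- **`(RV)` at the end of a pendant path of any length at a roots-only vertex.** -/
theorem rv_of_pendantPath_rootsOnly (p : E → R) (hp : IsProbVec p)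
    (h : IsPendantPathAt (RootsOnlyAnchor o a₁ a₂ b) o a₁ a₂ b n E ends v a₃)
    (hT : 0 < prob p (Tp ends a₁ a₂ a₃)) : RV p ends o a₁ a₂ a₃ b :=
  rv_of_pendantPath (RootsOnlyAnchor o a₁ a₂ b) (fourForms_of_rootsOnlyAnchor o a₁ a₂ b) p hp h hT

/-- **The four forms at the end of a pendant path of any length at a roots-and-`o` vertex.** -/
theorem fourForms_of_pendantPath_rootsAndO (p : E → R) (hp : IsProbVec p)
    (h : IsPendantPathAt (RootsAndOAnchor o a₁ a₂ b) o a₁ a₂ b n E ends v a₃) :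
    FourForms p ends o a₁ a₂ a₃ b :=
  fourForms_of_pendantPath (RootsAndOAnchor o a₁ a₂ b) o a₁ a₂ b
    (fourForms_of_rootsAndOAnchor o a₁ a₂ b) n E ends p hp v a₃ h

/-- **`(J1)` at the end of a pendant path of any length at a roots-and-`o` vertex.** -/
theorem jOne_of_pendantPath_rootsAndO (p : E → R) (hp : IsProbVec p)
    (h : IsPendantPathAt (RootsAndOAnchor o a₁ a₂ b) o a₁ a₂ b n E ends v a₃) :
    JOne p ends o a₁ a₂ a₃ b :=
  jOne_of_pendantPath (RootsAndOAnchor o a₁ a₂ b) (fourForms_of_rootsAndOAnchor o a₁ a₂ b)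
    (fun E' _ _ ends' p' hp' v' h' =>
      fourForms_of_rootsAndOAnchor o a₂ a₁ b E' ends' p' hp' v' (RootsAndOAnchor.swap o a₁ a₂ b E' ends' v' h'))
    p hp h

/-- **`(RV)` at the end of a pendant path of any length at a roots-and-`o` vertex.** -/
theorem rv_of_pendantPath_rootsAndO (p : E → R) (hp : IsProbVec p)
    (h : IsPendantPathAt (RootsAndOAnchor o a₁ a₂ b) o a₁ a₂ b n E ends v a₃)
    (hT : 0 < prob p (Tp ends a₁ a₂ a₃)) : RV p ends o a₁ a₂ a₃ b :=
  rv_of_pendantPath (RootsAndOAnchor o a₁ a₂ b) (fourForms_of_rootsAndOAnchor o a₁ a₂ b) p hp h hT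

end Anchors

end CaseOne

end Summit.Ventures.PercRepro2
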